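import Summits.ResolutionOfSingularities.ResolutionOfSingularities.Theorems.PurelyInseparableDim4PiPlateauClasses
import Literature.Barriers.ResolutionOfSingularities.ResidualOrderUnboundedProofs
import HarnessLib

/-!
# Π, brick T2: BRICK DATA of a witness class (cell `res-dim4-pi`, I-5-5)

[OURS · counted 0 · instrument lemma]  Nothing here is a statement about resolution of singularities in
dimension ≥ 4 / characteristic `p`, which is NOT proved.  Sections §1 «the identity `G_A = E · G̃`» and §2
«degree bounds / lower bounds» of res-dim4-idea-5's consolidated write-up `PiPlateau-consolidated.md`
(ecef900b4de1a97c) and typing blueprint `PiPlateau-typing-blueprint.md` (d8a3f498d0e42ada, §B–§C), over the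
T1 vocabulary (`Plateau.tPart / uPart / cls / classPoly`, `…PiPlateauClasses`):

* `brickPoly q j t F r A = Q_A := Σ_{cls b = cls A} c_b x^{b_T − r_T}` and **`classPoly_eq_translate_mul_brickPoly`**:
  `G_{cls A} = translate t (x^{r_T} · Q_A)` — literally the polynomial of `HasseEuler.step_alpha_core` /
  `step_beta_core` with `B = Q_A.support`, `c = coeff · Q_A`;
* the support of `Q_A` (`coeff_brickPoly`, `mem_support_brickPoly`, `exists_of_mem_support_brickPoly`) and the
  class degree identity `degree_tPart_add_apply_eq` (`|b_T| + b_j` is constant on a class) with the degree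
  bound `degree_brick_add_le` (‹hdeg_alpha› / ‹hdeg_beta› of the blueprint);
* the structure of the monomials of the point transform (`exists_of_coeff_pointTransform_ne_zero`,
  `uPart_eq_zero_of_mem_support_classPoly`, `coeff_cls_add_pointTransform`, `coeff_cls_add_step`);
* the LOWER-BOUND exponent `rho q j t r o = x_j^{o − q} · x_U^{r_U}` with `rho_le_of_mem_support_step` (every
  monomial of the child is divisible by it), `support_rho_subset` (it lives on the new exceptional set) and
  `degree_rho_le_degree_exceptionalExp_step` (`|ρ| ≤ |r′|`).

Typed by res-dim4-typ-1.  Supports stmt-ResolutionOfSingularities-16155 (helper).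
bears_on: LADDER-RESOLUTION:D157-DOOR2 (res-dim4-pi · I-5-5 Π · T2 brick data).
-/

set_option linter.dupNamespace false -- mandated namespace of this single-conjunct summit

namespace Summit.ResolutionOfSingularities.ResolutionOfSingularities.Theorems.PIDim4

namespace Plateau

open MvPolynomial Finset
open Literature.AlgebraicGeometry.Resolution
open Literature.AlgebraicGeometry.Resolution.Hauser2010
open Literature.AlgebraicGeometry.Resolution.CentreBlowup
open Literature.Barriers.ResolutionOfSingularities
open Literature.Barriers.ResolutionOfSingularities.HauserPerlega

variable {σ : Type*} {K : Type*} [Field K] [DecidableEq K]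

/-! ## §1 More on the translated / untranslated parts -/

/-- `tPart` is monotone. [folklore] -/
theorem tPart_mono (t : σ → K) {b b' : σ →₀ ℕ} (h : b ≤ b') : tPart t b ≤ tPart t b' :=
  Finsupp.le_def.mpr fun m => by
    rw [tPart_apply, tPart_apply]; split_ifs
    · exact h m
    · exact le_rfl

/-- `uPart` is monotone. [folklore] -/
theorem uPart_mono (t : σ → K) {b b' : σ →₀ ℕ} (h : b ≤ b') : uPart t b ≤ uPart t b' :=
  Finsupp.le_def.mpr fun m => by
    rw [uPart_apply, uPart_apply]; split_ifs
    · exact h m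
    · exact le_rfl

/-- `uPart b ≤ b`. [folklore] -/
theorem uPart_le (t : σ → K) (b : σ →₀ ℕ) : uPart t b ≤ b :=
  Finsupp.le_def.mpr fun m => by rw [uPart_apply]; split_ifs <;> omega

/-- `|b| = |b_U| + |b_T|`. [folklore] -/
theorem degree_eq_uPart_add_tPart (t : σ → K) (b : σ →₀ ℕ) :
    b.degree = (uPart t b).degree + (tPart t b).degree := by
  conv_lhs => rw [← uPart_add_tPart t b]
  rw [map_add]

/-- An exponent supported in the untranslated variables is its own `uPart`. [folklore] -/
theorem uPart_eq_self_of (t : σ → K) {b : σ →₀ ℕ} (h : ∀ m ∈ b.support, t m = 0) : uPart t b = b := by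
  have := uPart_add_tPart t b
  rwa [tPart_eq_zero_of t h, add_zero] at this

/-- An exponent with `uPart = 0` is its own `tPart`. [folklore] -/
theorem tPart_eq_self_of_uPart_eq_zero (t : σ → K) {k : σ →₀ ℕ} (h : uPart t k = 0) : tPart t k = k := by
  have := uPart_add_tPart t k
  rwa [h, zero_add] at this

/-- The chart entry is bounded by the untranslated degree (`t j = 0`). [folklore] -/
theorem apply_le_degree_uPart {t : σ → K} {j : σ} (ht : t j = 0) (b : σ →₀ ℕ) :
    b j ≤ (uPart t b).degree := by
  have h := Finsupp.le_degree j (uPart t b)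
  rwa [uPart_apply, if_pos ht] at h

variable [DecidableEq σ]

/-- `cls b` is untranslated: `uPart (cls b) = cls b`. [folklore] -/
theorem uPart_cls (q : ℕ) {j : σ} {t : σ → K} (ht : t j = 0) (b : σ →₀ ℕ) :
    uPart t (cls q j t b) = cls q j t b :=
  uPart_eq_self_of t fun _ hm => apply_eq_zero_of_mem_support_cls q ht b hm

/-- `tPart (cls b) = 0`. [folklore] -/
theorem tPart_cls (q : ℕ) {j : σ} {t : σ → K} (ht : t j = 0) (b : σ →₀ ℕ) : tPart t (cls q j t b) = 0 :=
  tPart_eq_zero_of t fun _ hm => apply_eq_zero_of_mem_support_cls q ht b hm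

variable [Fintype σ]

/-- `|cls b| + b_j + q = |b_U| + |b|` (for `q ≤ |b|`, `t j = 0`). [folklore] -/
theorem degree_cls_add (q : ℕ) {j : σ} {t : σ → K} (ht : t j = 0) {b : σ →₀ ℕ} (hq : q ≤ b.degree) :
    (cls q j t b).degree + b j + q = (uPart t b).degree + b.degree := by
  have h := PointBlowup.degree_update_add (uPart t b) j (b.degree - q)
  rw [uPart_apply, if_pos ht] at h
  unfold cls
  omega

/-- **The class degree identity**: `|b_T| + b_j` is constant on a class (exponents of degree `≥ q`). [folklore] -/
theorem degree_tPart_add_apply_eq (q : ℕ) {j : σ} {t : σ → K} (ht : t j = 0) {b A : σ →₀ ℕ}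
    (hq : q ≤ b.degree) (hqA : q ≤ A.degree) (hcls : cls q j t b = cls q j t A) :
    (tPart t b).degree + b j = (tPart t A).degree + A j := by
  have h1 := degree_cls_add q ht hq
  have h2 := degree_cls_add q ht hqA
  have h3 := degree_eq_uPart_add_tPart t b
  have h4 := degree_eq_uPart_add_tPart t A
  have h5 : b.degree - q = A.degree - q := by
    have := DFunLike.congr_fun hcls j
    rwa [cls_apply, cls_apply, if_pos rfl, if_pos rfl] at this
  rw [hcls] at h1
  omega

/-! ## §2 The brick polynomial `Q_A` and `G_{cls A} = translate t (x^{r_T} · Q_A)` -/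

omit [Fintype σ] in
/-- **The brick polynomial** of the class of `A`: `Q_A = Σ_{b ∈ supp F, cls b = cls A} c_b · x^{b_T − r_T}`
(the exceptional `T`-monomial `x^{r_T}` divided out). [folklore] -/
noncomputable def brickPoly (q : ℕ) (j : σ) (t : σ → K) (F : MvPolynomial σ K) (r A : σ →₀ ℕ) :
    MvPolynomial σ K :=
  ∑ b ∈ F.support with cls q j t b = cls q j t A, monomial (tPart t b - tPart t r) (coeff b F)

omit [Fintype σ] in
/-- **`G_{cls A} = E · G̃`**: the class polynomial is the translate of `x^{r_T} · Q_A` whenever `x^r` divides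
every monomial of `F`. [folklore] -/
theorem classPoly_eq_translate_mul_brickPoly (q : ℕ) (j : σ) (t : σ → K) (F : MvPolynomial σ K)
    {r : σ →₀ ℕ} (hr : ∀ b ∈ F.support, r ≤ b) (A : σ →₀ ℕ) :
    classPoly q j t F (cls q j t A) =
      PointBlowup.translate t (monomial (tPart t r) (1 : K) * brickPoly q j t F r A) := by
  unfold classPoly brickPoly
  rw [Finset.mul_sum, HasseEuler.translate_sum']
  refine Finset.sum_congr rfl fun b hb => ?_
  rw [monomial_mul, one_mul, add_tsub_cancel_of_le (tPart_mono t (hr b (Finset.mem_filter.mp hb).1))]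

/-- The coefficient of `x^{b_T − r_T}` in `Q_A` is `c_b` (`b` in the class of `A`). [folklore] -/
theorem coeff_brickPoly (q : ℕ) {j : σ} {t : σ → K} (ht : t j = 0) {F : MvPolynomial σ K}
    (hq : ∀ b ∈ F.support, q ≤ b.degree) {r : σ →₀ ℕ} (hr : ∀ b ∈ F.support, r ≤ b) {A b : σ →₀ ℕ}
    (hb : b ∈ F.support) (hcls : cls q j t b = cls q j t A) :
    coeff (tPart t b - tPart t r) (brickPoly q j t F r A) = coeff b F := by
  unfold brickPoly
  have hmem : b ∈ F.support.filter (fun b => cls q j t b = cls q j t A) := Finset.mem_filter.mpr ⟨hb, hcls⟩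
  refine PointBlowup.coeff_sum_monomial_of_injOn _ (fun b => tPart t b - tPart t r) (fun b => coeff b F)
    hmem fun b' hb' _ heq => ?_
  obtain ⟨hb'F, hcls'⟩ := Finset.mem_filter.mp hb'
  have hT : tPart t b' = tPart t b := by
    have h1 := tPart_mono t (hr b' hb'F)
    have h2 := tPart_mono t (hr b hb)
    have heq' : tPart t b' - tPart t r = tPart t b - tPart t r := heq
    rw [← tsub_add_cancel_of_le h1, ← tsub_add_cancel_of_le h2, heq']
  exact eq_of_cls_eq_of_tPart_eq q ht (hq b' hb'F) (hq b hb) (hcls'.trans hcls.symm) hT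

/-- Hence `b_T − r_T ∈ supp Q_A` for `b` in the class of `A`. [folklore] -/
theorem mem_support_brickPoly (q : ℕ) {j : σ} {t : σ → K} (ht : t j = 0) {F : MvPolynomial σ K}
    (hq : ∀ b ∈ F.support, q ≤ b.degree) {r : σ →₀ ℕ} (hr : ∀ b ∈ F.support, r ≤ b) {A b : σ →₀ ℕ}
    (hb : b ∈ F.support) (hcls : cls q j t b = cls q j t A) :
    tPart t b - tPart t r ∈ (brickPoly q j t F r A).support := by
  rw [MvPolynomial.mem_support_iff, coeff_brickPoly q ht hq hr hb hcls]
  exact MvPolynomial.mem_support_iff.mp hb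

omit [Fintype σ] in
/-- Every monomial of `Q_A` comes from a class element. [folklore] -/
theorem exists_of_mem_support_brickPoly (q : ℕ) (j : σ) (t : σ → K) (F : MvPolynomial σ K)
    (r A : σ →₀ ℕ) {β : σ →₀ ℕ} (hβ : β ∈ (brickPoly q j t F r A).support) :
    ∃ b ∈ F.support, cls q j t b = cls q j t A ∧ tPart t b - tPart t r = β := by
  obtain ⟨b, hb, -, h⟩ := PointBlowup.exists_of_mem_support_sum_monomial _ _ _ hβ
  exact ⟨b, (Finset.mem_filter.mp hb).1, (Finset.mem_filter.mp hb).2, h⟩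

omit [Fintype σ] in
/-- The coefficients of `Q_A` on its support are non-zero (the `hc` of the bricks). [folklore] -/
theorem coeff_ne_zero_of_mem_support_brickPoly (q : ℕ) (j : σ) (t : σ → K) (F : MvPolynomial σ K)
    (r A : σ →₀ ℕ) : ∀ β ∈ (brickPoly q j t F r A).support, coeff β (brickPoly q j t F r A) ≠ 0 :=
  fun _ hβ => MvPolynomial.mem_support_iff.mp hβ

omit [Fintype σ] in
/-- `Q_A` as the sum over its support (the `Σ_{β ∈ B} monomial β (c β)` of the bricks). [folklore] -/
theorem brickPoly_eq_sum_support (q : ℕ) (j : σ) (t : σ → K) (F : MvPolynomial σ K) (r A : σ →₀ ℕ) :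
    brickPoly q j t F r A =
      ∑ β ∈ (brickPoly q j t F r A).support, monomial β (coeff β (brickPoly q j t F r A)) :=
  (brickPoly q j t F r A).as_sum

/-- **Degree bound on a class** (‹hdeg›): `|b_T − r_T| + |r_T| + r_j ≤ |A_T| + A_j` for `b` in the class of
`A`, when `x^r` divides `x^b`. [folklore] -/
theorem degree_brick_add_le (q : ℕ) {j : σ} {t : σ → K} (ht : t j = 0) {b A r : σ →₀ ℕ}
    (hq : q ≤ b.degree) (hqA : q ≤ A.degree) (hcls : cls q j t b = cls q j t A) (hr : r ≤ b) :
    (tPart t b - tPart t r).degree + (tPart t r).degree + r j ≤ (tPart t A).degree + A j := by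
  have h1 := degree_tPart_add_apply_eq q ht hq hqA hcls
  have h2 : (tPart t b - tPart t r).degree + (tPart t r).degree = (tPart t b).degree := by
    rw [← map_add, tsub_add_cancel_of_le (tPart_mono t hr)]
  have h3 : r j ≤ b j := hr j
  omega

/-- The same for every `β ∈ supp Q_A`, with `r` dividing all monomials of `F`. [folklore] -/
theorem degree_add_le_of_mem_support_brickPoly (q : ℕ) {j : σ} {t : σ → K} (ht : t j = 0)
    {F : MvPolynomial σ K} (hq : ∀ b ∈ F.support, q ≤ b.degree) {r : σ →₀ ℕ}
    (hr : ∀ b ∈ F.support, r ≤ b) {A : σ →₀ ℕ} (hA : A ∈ F.support) {β : σ →₀ ℕ}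
    (hβ : β ∈ (brickPoly q j t F r A).support) :
    β.degree + (tPart t r).degree + r j ≤ (tPart t A).degree + A j := by
  obtain ⟨b, hb, hcls, rfl⟩ := exists_of_mem_support_brickPoly q j t F r A hβ
  exact degree_brick_add_le q ht (hq b hb) (hq A hA) hcls (hr b hb)

/-! ## §3 Monomials of the point transform and of the child, class by class -/

/-- A monomial `x^D` of the point transform comes from a class element `b` with `cls b = D_U`, through a
monomial of `translate t (x^{b_T})`. [folklore] -/
theorem exists_of_coeff_pointTransform_ne_zero (q : ℕ) {j : σ} {t : σ → K} (ht : t j = 0)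
    (s : CState σ K) {D : σ →₀ ℕ} (hD : coeff D (pointTransform q Finset.univ j t s) ≠ 0) :
    ∃ b ∈ s.F.support, cls q j t b = uPart t D ∧
      coeff (tPart t D) (PointBlowup.translate t (monomial (tPart t b) (coeff b s.F))) ≠ 0 := by
  rw [coeff_pointTransform q ht, classPoly, coeff_sum] at hD
  obtain ⟨b, hb, hne⟩ := Finset.exists_ne_zero_of_sum_ne_zero hD
  exact ⟨b, (Finset.mem_filter.mp hb).1, (Finset.mem_filter.mp hb).2, hne⟩

/-- Monomials of a class polynomial live in the translated variables. [folklore] -/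
theorem uPart_eq_zero_of_mem_support_classPoly (q : ℕ) (j : σ) (t : σ → K) (F : MvPolynomial σ K)
    {γ k : σ →₀ ℕ} (hk : k ∈ (classPoly q j t F γ).support) : uPart t k = 0 := by
  unfold classPoly at hk
  rw [MvPolynomial.mem_support_iff, coeff_sum] at hk
  obtain ⟨b, -, hne⟩ := Finset.exists_ne_zero_of_sum_ne_zero hk
  exact uPart_eq_zero_of_coeff_translate_tPart t b _ hne

/-- **Coefficient of a class monomial** `x^{cls A} · x^k` (`k` in the translated variables) in the point
transform: `coeff_k G_{cls A}`. [folklore] -/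
theorem coeff_cls_add_pointTransform (q : ℕ) {j : σ} {t : σ → K} (ht : t j = 0) (s : CState σ K)
    (A : σ →₀ ℕ) {k : σ →₀ ℕ} (hk : uPart t k = 0) :
    coeff (cls q j t A + k) (pointTransform q Finset.univ j t s) = coeff k (classPoly q j t s.F (cls q j t A)) := by
  rw [coeff_pointTransform q ht, uPart_add, uPart_cls q ht, hk, add_zero, tPart_add, tPart_cls q ht, zero_add,
    tPart_eq_self_of_uPart_eq_zero t hk]

/-- … and in the CHILD (after cleaning). [folklore] -/
theorem coeff_cls_add_step (q : ℕ) {j : σ} {t : σ → K} (ht : t j = 0) (s : CState σ K) (A : σ →₀ ℕ)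
    {k : σ →₀ ℕ} (hk : uPart t k = 0) :
    coeff (cls q j t A + k) (CentreBlowup.step q Finset.univ j t s).F =
      if IsPthPowerExponent q (cls q j t A + k) then 0 else coeff k (classPoly q j t s.F (cls q j t A)) := by
  rw [coeff_step_F q ht, uPart_add, uPart_cls q ht, hk, add_zero, tPart_add, tPart_cls q ht, zero_add,
    tPart_eq_self_of_uPart_eq_zero t hk]

/-- A monomial of the child is a monomial of the point transform. [folklore] -/
theorem coeff_pointTransform_ne_zero_of_mem_support_step (q : ℕ) (j : σ) (t : σ → K) (s : CState σ K)
    {D : σ →₀ ℕ} (hD : D ∈ (CentreBlowup.step q Finset.univ j t s).F.support) :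
    coeff D (pointTransform q Finset.univ j t s) ≠ 0 := by
  intro h
  rw [MvPolynomial.mem_support_iff,
    show (CentreBlowup.step q Finset.univ j t s).F = deletePthPowers q (pointTransform q Finset.univ j t s)
      from rfl, coeff_deletePthPowers] at hD
  split_ifs at hD with hP
  · exact hD rfl
  · exact hD h

/-! ## §4 The lower-bound exponent `ρ = x_j^{o − q} · x_U^{r_U}` -/

omit [Fintype σ] in
/-- `ρ := (r_U).update j (o − q)`: the exponent dividing every monomial of the child (`o = ord₀ F`,
`r` the exceptional exponent of the parent). [folklore] -/
noncomputable def rho (q : ℕ) (j : σ) (t : σ → K) (r : σ →₀ ℕ) (o : ℕ) : σ →₀ ℕ :=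
  (uPart t r).update j (o - q)

omit [Fintype σ] in
/-- Values of `ρ`. [folklore] -/
theorem rho_apply (q : ℕ) (j : σ) (t : σ → K) (r : σ →₀ ℕ) (o : ℕ) (m : σ) :
    rho q j t r o m = if m = j then o - q else if t m = 0 then r m else 0 := by
  unfold rho; rw [Finsupp.update_apply, uPart_apply]

omit [Fintype σ] in
/-- `ρ ≤ cls b` for every exponent `b` divisible by `x^r` of degree `≥ o`. [folklore] -/
theorem rho_le_cls (q : ℕ) (j : σ) (t : σ → K) {r b : σ →₀ ℕ} {o : ℕ} (hr : r ≤ b) (ho : o ≤ b.degree) :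
    rho q j t r o ≤ cls q j t b :=
  Finsupp.le_def.mpr fun m => by
    rw [rho_apply, cls_apply]
    by_cases hmj : m = j
    · rw [if_pos hmj, if_pos hmj]; omega
    · rw [if_neg hmj, if_neg hmj]
      split_ifs
      · exact hr m
      · exact le_rfl

/-- **Every monomial of the point transform is divisible by `x^ρ`.** [folklore] -/
theorem rho_le_of_coeff_pointTransform_ne_zero (q : ℕ) {j : σ} {t : σ → K} (ht : t j = 0) (s : CState σ K)
    {r : σ →₀ ℕ} (hr : ∀ b ∈ s.F.support, r ≤ b) {o : ℕ} (ho : ∀ b ∈ s.F.support, o ≤ b.degree)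
    {D : σ →₀ ℕ} (hD : coeff D (pointTransform q Finset.univ j t s) ≠ 0) : rho q j t r o ≤ D := by
  obtain ⟨b, hb, hcls, -⟩ := exists_of_coeff_pointTransform_ne_zero q ht s hD
  exact ((rho_le_cls q j t (hr b hb) (ho b hb)).trans (le_of_eq hcls)).trans (uPart_le t D)

/-- **Every monomial of the child is divisible by `x^ρ`.** [folklore] -/
theorem rho_le_of_mem_support_step (q : ℕ) {j : σ} {t : σ → K} (ht : t j = 0) (s : CState σ K)
    {r : σ →₀ ℕ} (hr : ∀ b ∈ s.F.support, r ≤ b) {o : ℕ} (ho : ∀ b ∈ s.F.support, o ≤ b.degree)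
    {D : σ →₀ ℕ} (hD : D ∈ (CentreBlowup.step q Finset.univ j t s).F.support) : rho q j t r o ≤ D :=
  rho_le_of_coeff_pointTransform_ne_zero q ht s hr ho (coeff_pointTransform_ne_zero_of_mem_support_step q j t s hD)

/-- `ρ` (built from the exceptional exponent of the parent) lives on the NEW exceptional set
`Δ′ = {j} ∪ {u ∈ Δ : t u = 0}`. [folklore] -/
theorem support_rho_subset (q : ℕ) (j : σ) (t : σ → K) (s : CState σ K) (o : ℕ) :
    (rho q j t (exceptionalExp s.exc s.F) o).support ⊆ (CentreBlowup.step q Finset.univ j t s).exc := by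
  intro m hm
  show m ∈ insert j (s.exc.filter fun i => t i = 0)
  rw [Finsupp.mem_support_iff, rho_apply] at hm
  by_cases hmj : m = j
  · rw [hmj]; exact Finset.mem_insert_self _ _
  · rw [if_neg hmj] at hm
    by_cases htm : t m = 0
    · rw [if_pos htm] at hm
      have hmΔ : m ∈ s.exc := by
        by_contra h
        exact hm (exceptionalExp_apply_eq_zero_of_not_mem _ h)
      exact Finset.mem_insert_of_mem (Finset.mem_filter.mpr ⟨hmΔ, htm⟩)
    · exact absurd (if_neg htm) hm

/-- `|ρ| + r_j = |r_U| + (o − q)` (`t j = 0`). [folklore] -/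
theorem degree_rho_add (q : ℕ) {j : σ} {t : σ → K} (ht : t j = 0) (r : σ →₀ ℕ) (o : ℕ) :
    (rho q j t r o).degree + r j = (uPart t r).degree + (o - q) := by
  have h := PointBlowup.degree_update_add (uPart t r) j (o - q)
  rw [uPart_apply, if_pos ht] at h
  exact h

/-- **`|ρ| ≤ |r′|`**: the exceptional exponent of the (non-zero) child w.r.t. `Δ′` has degree at least `|ρ|`
(every monomial of the child is divisible by `x^ρ` and `ρ` lives on `Δ′`). [folklore] -/
theorem degree_rho_le_degree_exceptionalExp_step (q : ℕ) {j : σ} {t : σ → K} (ht : t j = 0)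
    (s : CState σ K) {o : ℕ} (ho : ∀ b ∈ s.F.support, o ≤ b.degree)
    (hne : (CentreBlowup.step q Finset.univ j t s).F ≠ 0) :
    (rho q j t (exceptionalExp s.exc s.F) o).degree ≤
      (exceptionalExp (CentreBlowup.step q Finset.univ j t s).exc (CentreBlowup.step q Finset.univ j t s).F).degree := by
  set ρ := rho q j t (exceptionalExp s.exc s.F) o with hρ
  set s' := CentreBlowup.step q Finset.univ j t s with hs'
  have hr : ∀ b ∈ s.F.support, exceptionalExp s.exc s.F ≤ b :=
    fun b hb => exceptionalExp_le_exponent_of_mem_support s.exc hb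
  obtain ⟨D₀, hD₀⟩ := MvPolynomial.support_nonempty.mpr hne
  have hρD : ∀ D ∈ s'.F.support, ρ ≤ D := fun D hD => rho_le_of_mem_support_step q ht s hr ho hD
  rw [degree_exceptionalExp_eq_sum_toNat, Finsupp.degree_eq_sum,
    ← Finset.sum_subset (Finset.subset_univ s'.exc) fun m _ hm =>
      Finsupp.notMem_support_iff.mp fun h => hm (support_rho_subset q j t s o h)]
  refine Finset.sum_le_sum fun m _ => ?_
  have h1 : ((ρ m : ℕ) : ℕ∞) ≤ ordAlong m s'.F :=
    natCast_le_ordAlong_of_forall_mem_support m (ρ m) fun D hD => hρD D hD m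
  have hne' : ordAlong m s'.F ≠ ⊤ :=
    ne_top_of_le_ne_top (ENat.coe_ne_top _) (ordAlong_le_apply_of_mem_support hD₀ m)
  rw [← ENat.coe_toNat hne'] at h1
  exact_mod_cast h1

end Plateau

end Summit.ResolutionOfSingularities.ResolutionOfSingularities.Theorems.PIDim4
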